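import Literature.MathematicalPhysics.QuantumFieldTheory.Balaban1985CMP102.SectB

/-!
# Bałaban CMP 102 (1985) 255–275, AS-PRINTED SPINE — `SectBLowerBound`: the lower bounds (37) p. 265 and (47) p. 267
# with THEIR OWN characteristic functions `χ₁`, `χ_k` (restrictions on `V` through the minimizer `U_k(V)` on `T_η`),
# typed literally next to `SectB.TowerObjects.Ineq47AsPrinted` (which carries the Introduction's `χ` of (4)), and the
# unprinted inclusions between the two small-field domains as hypothesis-shaped `Prop`s (an ADDENDUM file: `SectB.lean`
# stays byte-stable; dot-notation extensions of `SectB.TowerObjects` declared from this file of the same directory)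

Source: T. Bałaban, *Ultraviolet stability of three-dimensional lattice pure gauge field theories*, Commun. Math. Phys.
**102** (1985) 255–275 [Balaban1985UV3] ([B10]; `paper:balaban1985-cmp102-uv-stability-3d`; PDF page = journal page −
254).  Quotations READ AS IMAGES on the renders `run/shared/lean/pub/pub-balaban/b2b-balaban-ref1/pages/
1985-cmp102-uv-stability-3d/…-p002-x2.png` (p. 256), `…-p011-x2.png` (p. 265), `…-p013-x2.png` (p. 267); locators
`p. N (= PDF n) Lm` = line m of the TEXT-LAYER file `p00nn.txt` materialised by `lit read` (running head = L1; a
display counts as the lines the layer gives it), the convention of `Setting.lean`/`SectB.lean`.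

WHAT [B10] PRINTS — TWO characteristic functions.  (i) p. 256 L24–27, **(4)**: «The function χ(U) is a characteristic
function of the domain  |U(∂p) − 1| < ε₁,  p ⊂ T₁^{(K)},  (4)  where ε₁ is a sufficiently small positive constant, which
will be chosen later.», used in (3) and in (5) p. 256 L31–36 («… determined by the configuration U on T₁^{(k)}, and
satisfying (4)») — a restriction on the plaquette variables OF THE FIELD on the unit lattice `T₁^{(k)}`; this is
`Setting.RunObjects.chi k` (threshold the binder `ε₁ k`; print's later choices of `ε₁` are (7) p. 257 L34 «ε₁ = g₀p(g₀)»
and p. 267 L36–37 «with ε₁ = g_kp(g_k)», both for the decomposition of unity).  (ii) p. 265 L24–27, before **(37)**: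
«Let us make a remark about a lower bound. We introduce restrictions on fields in a slightly different way. The
characteristic function χ₁ denotes restrictions on V of the form |U₁(∂p) − 1| < L⁻²g₀p(g₁), where U₁ = U₁(V) is the
minimal configuration determined by V.» and p. 267 L19–20, the «where»-clause of **(47)**: «where the characteristic
function χ_k corresponds to the restrictions on V given by the conditions |U_k(∂p) − 1| < g_kp(g_k)η², p ⊂ T_η.» — a
restriction on `V` THROUGH ITS MINIMIZER `U_k(V)` on the fine lattice `T_η`, threshold scaled by `η² = L^{−2k}`; this is
`SectB.TowerObjects.Chi47Restriction k V` (typed in `SectB.lean`, not used there in an inequality).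

WHAT THE TREE DID WITH (47).  `SectB.TowerObjects.Ineq47AsPrinted W k := B10.Ineq47 W.toTowerRun k` reads the 4D cell's
ONE `k`-indexed family `B10.RunData.χ`, which on the concrete objects is the Introduction's `χ` of (4)
(`RunObjects.toRunData`, `χ := R.chi`): the inequality (47) is typed with `χ_(4)` in the place of print's `χ_k` — the
RECORDED IDENTIFICATION of the 4D cell (lane pub-balaban GAPS.md row G-pv15-1: «unprinted identification of two different
printed characteristic functions in the LOWER bound; located; constants only»; its analysis: deriving the lower half of
(5) from (47) — p. 274 L3–4 «The lower bound is simpler, it is enough to use (44)–(46) and (66).» — needs `χ ≤ χ_k`,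
i.e. (4) ⇒ the (47)-restriction, which by [7] Thm 1 (8) with (2) holds when `B₃ε₁ ≤ g_kp(g_k)`, «never stated»).

WHAT THIS FILE ADDS (lane pub-balaban3d, prover seat p4's reading flag 2026-08-22T03:04:57Z; typer-1 rows (37), (47)).
No statement of `SectB.lean` changes.  `chi47 W k` = print's `χ_k` of (47) as a density factor (`Setup.chiSmall Set.univ`
at the minimizer `U_k(V) = UkH k (triv k) V`, threshold `g_kp(g_k)η²` — the tokens of `Chi47Restriction`);
`Ineq47Literal W k` = (47) with `χ_k` in its printed place (same exponent as `ineq47AsPrinted_iff`); `chi37 W`,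
`Ineq37Literal W` = (37) with its printed threshold «L⁻²g₀p(g₁)» ⟦sic; (47) at k = 1 reads g₁p(g₁)L⁻²⟧; the two
unprinted inclusions `Chi4SubChi47 W k` («(4)-domain ⊆ (47)-domain»: what (47) ⇒ (5) uses) and `Chi47SubChi4 W k` (the
converse: what reading the tree's `Ineq47AsPrinted` as print's (47) would use) as hypothesis-shaped `Prop`s, never
asserted; and the bridges `ineq47AsPrinted_of_literal` / `ineq47Literal_of_asPrinted` (monotonicity of `χ ↦ χ·e^F ≤ ρ`
in `χ`), `ineq37Literal_of_ineq47Literal_one` (threshold monotonicity, under the printed-threshold comparison as a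
hypothesis).  Bookkeeping theorems are one-line unfoldings; nothing of [7] or of the series is asserted.
-/

namespace Literature.MathematicalPhysics.QuantumFieldTheory.Balaban1985CMP102.SectB.TowerObjects

open Literature.MathematicalPhysics.QuantumFieldTheory.Balaban1983to89
open Literature.MathematicalPhysics.QuantumFieldTheory.Balaban1985CMP102.Setting

variable {L : ℕ} {S : Scales L} {G : Type} [Balaban1983to89.GaugeGroup G] [MeasurableSpace G]
  [Balaban1983to89.HaarData G] (W : TowerObjects S G)

/-! ## §1 Print's `χ_k` of (47) and (47) with it -/

/-- **Print's `χ_k` of (47)** p. 267 = PDF 13 L19–20, verbatim (render p013): «where the characteristic function χ_k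
corresponds to the restrictions on V given by the conditions |U_k(∂p) − 1| < g_kp(g_k)η², p ⊂ T_η.» — as a density
factor of `V` on `T₁^{(k)}`: the characteristic function `Setup.chiSmall` of ALL plaquettes of `T_η` (`Set.univ`) at
threshold `g_kp(g_k)η²` (`g_k` = `Scales.gk`, `p(·)` = `B10.pFun b₀ p₀` of (7), `η = L^{−k}` = `Scales.eta`), evaluated at
the minimizer `U_k(V)` of the history without large fields (`UkH k (triv k) V`: (42) with every `Ω_j = T_η`, i.e. the one
constraint `Ū^k = V` on `T₁^{(k)}`; = `Uk k V` by `UkH_triv`).  Its domain is `Chi47Restriction k V` (`chi47_eq_one_iff`).  Distinct from the Introduction's `χ` of (4)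
(`RunObjects.chi k`: the plaquettes of `V` itself, threshold `ε₁ k`); print does not relate the two (lane pub-balaban
GAPS G-pv15-1). [cite: Balaban1985UV3, (47) p.267] -/
noncomputable def chi47 (k : ℕ) : Balaban1983to89.Density S.P k G :=
  fun V => Balaban1983to89.chiSmall Set.univ
    (S.gk k * Balaban1983to89.B10.pFun W.b₀ W.p₀ (S.gk k) * S.eta k ^ 2) (W.UkH k (W.triv k) V)

/-- `χ_k(V) = 1` exactly on print's (47)-domain `Chi47Restriction k V` («|U_k(∂p) − 1| < g_kp(g_k)η², p ⊂ T_η»), else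
`χ_k(V) = 0` (`chi47_eq_zero_iff`).  One-line unfolding (`Setup.chiSmall`, `PlaqSmallOn Set.univ ↔ PlaqSmall`). [cite: Balaban1985UV3, (47) p.267] -/
theorem chi47_eq_one_iff (k : ℕ) (V : Balaban1983to89.GaugeField S.P k G) :
    W.chi47 k V = 1 ↔ W.Chi47Restriction k V := by
  unfold chi47 Balaban1983to89.chiSmall Chi47Restriction Balaban1983to89.PlaqSmallOn Balaban1983to89.PlaqSmall
  simp only [Set.mem_univ, forall_const]
  split_ifs with h
  · exact ⟨fun _ => h, fun _ => rfl⟩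
  · exact ⟨fun h0 => absurd h0 (by norm_num), fun h' => absurd h' h⟩

/-- Off print's (47)-domain `χ_k(V) = 0`. [cite: Balaban1985UV3, (47) p.267] -/
theorem chi47_eq_zero_iff (k : ℕ) (V : Balaban1983to89.GaugeField S.P k G) :
    W.chi47 k V = 0 ↔ ¬ W.Chi47Restriction k V := by
  unfold chi47 Balaban1983to89.chiSmall Chi47Restriction Balaban1983to89.PlaqSmallOn Balaban1983to89.PlaqSmall
  simp only [Set.mem_univ, forall_const]
  split_ifs with h
  · exact ⟨fun h1 => absurd h1 (by norm_num), fun h' => absurd h h'⟩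
  · exact ⟨fun _ => h, fun _ => rfl⟩

/-- `0 ≤ χ_k ≤ 1` (a characteristic function). [cite: Balaban1985UV3, (47) p.267] -/
theorem chi47_nonneg (k : ℕ) (V : Balaban1983to89.GaugeField S.P k G) : 0 ≤ W.chi47 k V := by
  unfold chi47 Balaban1983to89.chiSmall
  split_ifs <;> norm_num

/-- `χ_k ≤ 1` (a characteristic function). [cite: Balaban1985UV3, (47) p.267] -/
theorem chi47_le_one (k : ℕ) (V : Balaban1983to89.GaugeField S.P k G) : W.chi47 k V ≤ 1 := by
  unfold chi47 Balaban1983to89.chiSmall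
  split_ifs <;> norm_num

/-- **(47) with print's own `χ_k`** p. 267 = PDF 13 L17–20, verbatim (render p013): «Analogously to (37) we assume the
lower bound  ρ_k(V) ≥ χ_k exp[−(1/g_k²)A^η(U_k) + Σ_{j=1}^{k} Σ_{Y_j} 𝒫_j(Y_j,U_k) − E_k − Σ_{j=0}^{k−1}
O((L^jε)^{3+κ₀})|T₁^{(j)}|],  (47)  where the characteristic function χ_k corresponds to the restrictions on V given by
the conditions |U_k(∂p) − 1| < g_kp(g_k)η², p ⊂ T_η.» — for every `V` on `T₁^{(k)}`: `χ_k(V)·exp[−(1/g_k²)A^η(U_k(V)) +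
Σ_jΣ_{Y_j}𝒫_j(Y_j,U_k) − E_k − Σ_{j<k} rcoef_j (L^jε)^{3+κ₀}|T₁^{(j)}|] ≤ ρ_k(V)` with `χ_k` = `chi47` (the ONLY token in
which this differs from `ineq47AsPrinted_iff`, whose factor is the Introduction's `χ` of (4)); exponent: main term
`(S.gk k)⁻¹² · S.actionEta k (U_k)` ((41) L20), interaction sum `Pint k (triv k)` ((43)), `E_k` = `Ecst k` ((64)),
remainder `Rm k`; no `Z`-terms (no large fields).  Hypothesis-shaped (Theorem 2 p. 272 asserts it for the construction;
not asserted here). [cite: Balaban1985UV3, (47) p.267] -/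
def Ineq47Literal (k : ℕ) : Prop :=
  ∀ V : Balaban1983to89.GaugeField S.P k G,
    W.chi47 k V * Real.exp (-((S.gk k)⁻¹ ^ 2 * S.actionEta k (W.UkH k (W.triv k) V)) +
        W.Pint k (W.triv k) V - W.Ecst k - W.Rm k) ≤ W.rho k V

/-! ## §2 The two small-field domains: the unprinted inclusions, hypothesis-shaped -/

/-- **«(4)-domain ⊆ (47)-domain» at step `k`** — NOT IN PRINT (lane pub-balaban GAPS G-pv15-1; typed here so that it can
be consumed or attacked by name): every `V` on `T₁^{(k)}` in the Introduction's domain (4) p. 256 L26 «|U(∂p) − 1| < ε₁,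
p ⊂ T₁^{(K)}» (read at step `k` on the plaquettes of `T₁^{(k)}`, as (5) L35–36 uses it: `PlaqSmall (ε₁ k) V`, the domain of
`RunObjects.chi k`) satisfies print's (47)-restriction p. 267 L19–20
«|U_k(∂p) − 1| < g_kp(g_k)η², p ⊂ T_η» (`Chi47Restriction k V`).  This is what the passage (47) ⇒ lower half of (5)
(p. 274 L3–4 «The lower bound is simpler, it is enough to use (44)–(46) and (66).») uses (`χ ≤ χ_k`,
`chi_le_chi47`).  What print offers for it: [7] Thm 1 p. 279, (8) «for an arbitrary configuration V satisfying (7) with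
ε₁ ≤ a₁ there exists a minimal orbit in the space 𝔘_k({Ω_j}, B₃ε₁) ∩ 𝔅_k(𝔅_k, V)» with [7] (2) p. 278 «|U(∂p) − 1| =
|(∂U)(p) − 1| < ε₀L^{−2j} = ε₀η²(L^jη)^{−2} for p ∈ Ω_j, j = 0, 1, …, k» (no large fields: `|U_k(∂p) − 1| < B₃ε₁η²` on
`T_η`; `B11.Thm1Printed`) — i.e. the inclusion «(4)-domain at ε₁ ⊆ (47)-domain at B₃ε₁»; at EQUAL thresholds it holds
when `B₃·ε₁ k ≤ g_kp(g_k)`, a condition on the binder `ε₁ k` ([7]: «The constants a₀, a₁, B₃ depend on d and L only»)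
that [B10] never states.  Hypothesis-shaped; never asserted. [cite: Balaban1985UV3, (4) p.256 + (47) p.267] -/
def Chi4SubChi47 (k : ℕ) : Prop :=
  ∀ V : Balaban1983to89.GaugeField S.P k G, Balaban1983to89.PlaqSmall (W.ε₁ k) V → W.Chi47Restriction k V

/-- **«(47)-domain ⊆ (4)-domain» at step `k`** — NOT IN PRINT (the converse inclusion; lane pub-balaban GAPS G-pv15-1):
every `V` satisfying print's (47)-restriction «|U_k(∂p) − 1| < g_kp(g_k)η², p ⊂ T_η» lies in the Introduction's domain
(4) «|U(∂p) − 1| < ε₁, p ⊂ T₁^{(K)}» (read at step `k` on `T₁^{(k)}`) at the binder `ε₁ k`.  This is what reading the tree's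
`Ineq47AsPrinted` (factor
`χ_(4)`) AS print's (47) (factor `χ_k`) would use (`ineq47Literal_of_asPrinted`).  What print offers for it: `V = Ū_k^k`
on `T₁^{(k)}` ((42); [7] (3) p. 278 «Ū^j = V on Λ_j») and [7] p. 278, the sentence after (7): «Let us notice that if the
space (6) is non-empty and ε₀ is sufficiently small, then by Proposition 2 [4] the configuration V satisfies (7) with
ε₁ = O(ε₀).» ([4] Prop 2 (54) p. 26, `B7.Prop2Printed`: «|Ū^k(∂p) − 1| < α₀ + 2C₀α₀² < 2α₀» from «|U(∂p) − 1| < α₀η²») —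
i.e. the inclusion «(47)-domain at α₀ ⊆ (4)-domain at 2α₀»; at EQUAL thresholds (`ε₁ k = g_kp(g_k)`) it is not given by
print.  Hypothesis-shaped; never asserted. [cite: Balaban1985UV3, (4) p.256 + (47) p.267] -/
def Chi47SubChi4 (k : ℕ) : Prop :=
  ∀ V : Balaban1983to89.GaugeField S.P k G, W.Chi47Restriction k V → Balaban1983to89.PlaqSmall (W.ε₁ k) V

/-- Under «(4)-domain ⊆ (47)-domain» the Introduction's `χ` of (4) is dominated by print's `χ_k` of (47) pointwise:
`χ(V) ≤ χ_k(V)` (the form in which GAPS G-pv15-1 states the need).  Bookkeeping. [cite: Balaban1985UV3, (4) p.256 + (47) p.267] -/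
theorem chi_le_chi47 (k : ℕ) (hsub : W.Chi4SubChi47 k) (V : Balaban1983to89.GaugeField S.P k G) :
    W.chi k V ≤ W.chi47 k V := by
  by_cases hV : Balaban1983to89.PlaqSmall (W.ε₁ k) V
  · have h1 : W.chi47 k V = 1 := (W.chi47_eq_one_iff k V).2 (hsub V hV)
    rw [h1]
    unfold RunObjects.chi Balaban1983to89.chiSmall
    split_ifs <;> norm_num
  · have h0 : W.chi k V = 0 := by
      unfold RunObjects.chi Balaban1983to89.chiSmall
      rw [if_neg]
      intro h'
      exact hV fun p => h' p (Set.mem_univ p)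
    rw [h0]
    exact W.chi47_nonneg k V

/-- Under «(47)-domain ⊆ (4)-domain», conversely, `χ_k(V) ≤ χ(V)` pointwise.  Bookkeeping. [cite: Balaban1985UV3, (4) p.256 + (47) p.267] -/
theorem chi47_le_chi (k : ℕ) (hsub : W.Chi47SubChi4 k) (V : Balaban1983to89.GaugeField S.P k G) :
    W.chi47 k V ≤ W.chi k V := by
  by_cases hV : W.Chi47Restriction k V
  · have h1 : W.chi k V = 1 := by
      unfold RunObjects.chi Balaban1983to89.chiSmall
      rw [if_pos]
      exact fun p _ => hsub V hV p
    rw [h1]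
    exact W.chi47_le_one k V
  · rw [(W.chi47_eq_zero_iff k V).2 hV]
    unfold RunObjects.chi Balaban1983to89.chiSmall
    split_ifs <;> norm_num

/-! ## §3 Bridges between (47) as printed (`χ_k`) and (47) as the tree reads it (`χ` of (4)) -/

/-- A lower bound `χ·e^F ≤ ρ` is antitone in the characteristic function: if `χ ≤ χ'` pointwise then the bound with
`χ'` implies the bound with `χ`.  Private plumbing. [folklore] -/
private theorem lower_of_le {k : ℕ} {χ χ' : Balaban1983to89.Density S.P k G} (hle : ∀ V, χ V ≤ χ' V)
    (F : Balaban1983to89.GaugeField S.P k G → ℝ)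
    (h : ∀ V, χ' V * Real.exp (F V) ≤ W.rho k V) (V : Balaban1983to89.GaugeField S.P k G) :
    χ V * Real.exp (F V) ≤ W.rho k V :=
  (mul_le_mul_of_nonneg_right (hle V) (Real.exp_nonneg _)).trans (h V)

/-- **Print's (47) ⇒ the tree's (47)** under «(4)-domain ⊆ (47)-domain»: if `χ ≤ χ_k` (`Chi4SubChi47`), the lower
bound (47) with print's `χ_k` (`Ineq47Literal`) implies the lower bound with the Introduction's `χ` of (4)
(`Ineq47AsPrinted` = `B10.Ineq47 W.toTowerRun k`) — the direction the passage (47) ⇒ (5) p. 274 L3–4 uses.  Bookkeeping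
(monotonicity in the characteristic function); the inclusion is a hypothesis, not asserted. [cite: Balaban1985UV3, (47) p.267] -/
theorem ineq47AsPrinted_of_literal (k : ℕ) (hsub : W.Chi4SubChi47 k) (h : W.Ineq47Literal k) :
    W.Ineq47AsPrinted k :=
  (W.ineq47AsPrinted_iff k).2 fun V =>
    W.lower_of_le (W.chi_le_chi47 k hsub) (fun V => -((S.gk k)⁻¹ ^ 2 * S.actionEta k (W.UkH k (W.triv k) V)) +
      W.Pint k (W.triv k) V - W.Ecst k - W.Rm k) h V

/-- **The tree's (47) ⇒ print's (47)** under «(47)-domain ⊆ (4)-domain»: if `χ_k ≤ χ` (`Chi47SubChi4`), the lower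
bound with the Introduction's `χ` of (4) (`Ineq47AsPrinted`) implies (47) with print's `χ_k` (`Ineq47Literal`) — the
direction in which a construction verifying `Ineq47AsPrinted` (the lane's slot content, `specOK_pin`) delivers (47) AS
PRINTED.  Bookkeeping; the inclusion is a hypothesis, not asserted. [cite: Balaban1985UV3, (47) p.267] -/
theorem ineq47Literal_of_asPrinted (k : ℕ) (hsub : W.Chi47SubChi4 k) (h : W.Ineq47AsPrinted k) :
    W.Ineq47Literal k := fun V =>
  W.lower_of_le (W.chi47_le_chi k hsub) (fun V => -((S.gk k)⁻¹ ^ 2 * S.actionEta k (W.UkH k (W.triv k) V)) +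
      W.Pint k (W.triv k) V - W.Ecst k - W.Rm k) ((W.ineq47AsPrinted_iff k).1 h) V

/-- When the two small-field domains COINCIDE at step `k` (both inclusions), (47) as printed and (47) as the tree reads
it are equivalent.  Bookkeeping corollary of the two bridges. [cite: Balaban1985UV3, (47) p.267] -/
theorem ineq47Literal_iff_asPrinted (k : ℕ) (h₁ : W.Chi4SubChi47 k) (h₂ : W.Chi47SubChi4 k) :
    W.Ineq47Literal k ↔ W.Ineq47AsPrinted k :=
  ⟨W.ineq47AsPrinted_of_literal k h₁, W.ineq47Literal_of_asPrinted k h₂⟩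

/-! ## §4 (37): the first-step lower bound with its printed `χ₁` -/

/-- **Print's `χ₁` of (37)** p. 265 = PDF 11 L25–27, verbatim (render p011): «The characteristic function χ₁ denotes
restrictions on V of the form |U₁(∂p) − 1| < L⁻²g₀p(g₁), where U₁ = U₁(V) is the minimal configuration determined by
V.» — as a density factor of `V` on `T₁^{(1)}`: `Setup.chiSmall Set.univ` (all plaquettes of `T_η`, `η = L⁻¹`) at the
PRINTED threshold `g₀·p(g₁)·η²` with `η² = L⁻²` (`S.gk 0`, `B10.pFun b₀ p₀ (S.gk 1)`, `S.eta 1`) ⟦sic: the mixed indices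
`g₀p(g₁)` are print's; (47) at `k = 1` reads `g₁p(g₁)L⁻²` — cf. `chi47 W 1`; the seat transcription
`TRANSCRIPTION-pp258-267.md` and `B10.FirstStep36_37Printed` mark the same ⟦sic⟧⟧, evaluated at the minimizer `U₁(V)`
(`UkH 1 (triv 1) V`). [cite: Balaban1985UV3, (37) p.265] -/
noncomputable def chi37 : Balaban1983to89.Density S.P 1 G :=
  fun V => Balaban1983to89.chiSmall Set.univ
    (S.gk 0 * Balaban1983to89.B10.pFun W.b₀ W.p₀ (S.gk 1) * S.eta 1 ^ 2) (W.UkH 1 (W.triv 1) V)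

/-- **(37) with print's own `χ₁`** p. 265 = PDF 11 L28–29, verbatim (render p011; the display is empty in the text layer): «They give the inequality  ρ₁(V) ≥ χ₁
exp[−(1/g₁²)A^{L⁻¹}(U₁) + Σ_Y 𝒫₁(g₀, Y, U₁) − E₁ − O(ε^{3+κ₀})|T₁|].  (37)» — for every `V` on `T₁^{(1)}`:
`χ₁(V)·exp[−(1/g₁²)A^η(U₁(V)) + Σ_Y𝒫₁(g₀,Y,U₁) − E₁ − rcoef₀·ε^{3+κ₀}|T₁^{(0)}|] ≤ ρ₁(V)` with `χ₁` = `chi37`; the exponent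
is that of `Ineq47Literal W 1` (`A^{L⁻¹}` = `S.actionEta 1`, `Σ_Y𝒫₁` = `Pint 1 (triv 1)`, `E₁` = `Ecst 1` by (64),
`O(ε^{3+κ₀})|T₁|` = `Rm 1` = `rcoef 0 · (L⁰ε)^{3+κ₀} · |T₁^{(0)}|`).  Hypothesis-shaped ((36)–(37) are Sect. A's conclusion,
the 4D cell's leaf `B10.FirstStep36_37Printed` BY NAME carries the (4)-factor; not asserted here). [cite: Balaban1985UV3, (37) p.265] -/
def Ineq37Literal (W : TowerObjects S G) : Prop :=
  ∀ V : Balaban1983to89.GaugeField S.P 1 G,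
    W.chi37 V * Real.exp (-((S.gk 1)⁻¹ ^ 2 * S.actionEta 1 (W.UkH 1 (W.triv 1) V)) +
        W.Pint 1 (W.triv 1) V - W.Ecst 1 - W.Rm 1) ≤ W.rho 1 V

omit [MeasurableSpace G] [Balaban1983to89.HaarData G] in
/-- A characteristic function of small plaquettes is monotone in the threshold.  Private plumbing. [folklore] -/
private theorem chiSmall_univ_mono {j : ℕ} {δ δ' : ℝ} (hδ : δ ≤ δ') (U : Balaban1983to89.GaugeField S.P j G) :
    Balaban1983to89.chiSmall Set.univ δ U ≤ Balaban1983to89.chiSmall Set.univ δ' U := by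
  unfold Balaban1983to89.chiSmall
  by_cases h : Balaban1983to89.PlaqSmallOn Set.univ δ U
  · have h' : Balaban1983to89.PlaqSmallOn Set.univ δ' U := fun p hp => (h p hp).trans_le hδ
    rw [if_pos h, if_pos h']
  · rw [if_neg h]
    split_ifs <;> norm_num

/-- **(47) at `k = 1` ⇒ (37) as printed**, given the comparison of the two printed thresholds `g₀p(g₁)L⁻² ≤ g₁p(g₁)L⁻²`
as a hypothesis (`hthr`; it is `g₀ ≤ g₁`, i.e. `g(ε)^{1/2} ≤ g(Lε)^{1/2}`, times `p(g₁) ≥ 0` — facts about the profile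
(7)/(5) not unfolded here): the (37)-domain is then contained in the (47)₁-domain, `χ₁^{(37)} ≤ χ₁^{(47)}`, and the lower
bound descends.  Bookkeeping around print's ⟦sic⟧ `g₀p(g₁)`; (47) p. 267 L17 «Analogously to (37) we assume». [cite: Balaban1985UV3, (37) p.265 + (47) p.267] -/
theorem ineq37Literal_of_ineq47Literal_one
    (hthr : S.gk 0 * Balaban1983to89.B10.pFun W.b₀ W.p₀ (S.gk 1) * S.eta 1 ^ 2 ≤
      S.gk 1 * Balaban1983to89.B10.pFun W.b₀ W.p₀ (S.gk 1) * S.eta 1 ^ 2)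
    (h : W.Ineq47Literal 1) : W.Ineq37Literal := fun V =>
  W.lower_of_le (fun V => chiSmall_univ_mono hthr (W.UkH 1 (W.triv 1) V))
    (fun V => -((S.gk 1)⁻¹ ^ 2 * S.actionEta 1 (W.UkH 1 (W.triv 1) V)) +
      W.Pint 1 (W.triv 1) V - W.Ecst 1 - W.Rm 1) h V

/-! ## §5 The pinned objects -/

/-- `pin` (the slot «ρ_k satisfies (41), (47)» set to the tree's `(41)_k ∧ (47)_k`) does not change print's `χ_k` nor
(47) as printed: `Ineq47Literal` for `pin W` is `Ineq47Literal` for `W` (only `ρ_k` could differ, and `pin_rho`).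
Re-derived bookkeeping, no content of the paper. [cite: Balaban1985UV3, (47) p.267] -/
theorem ineq47Literal_pin_iff (k : ℕ) : W.pin.Ineq47Literal k ↔ W.Ineq47Literal k :=
  forall_congr' fun V => by
    have h : W.pin.rho k V = W.rho k V := congrFun (W.pin_rho k) V
    rw [h]
    exact Iff.rfl

end Literature.MathematicalPhysics.QuantumFieldTheory.Balaban1985CMP102.SectB.TowerObjects
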